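import Mathlib.Tactic.Linarith
import Mathlib.Tactic.Ring
import HarnessLib

/-!
# [OURS · L1 W4.5(b) · K5-BMY] Companion bookkeeping: the Chern-number arithmetic of LEAD-MEMO-3 (C), pinned

Cell `res-hironaka`, crux chain w45b, disprover object K5-BMY on the item EL♮ = `EquisingularLiftNat`
(stmt-ResolutionOfSingularities-20038) AS TYPED at `n = 5` (kill test #50; hand res-D-brk-4; `--supports stmt-ResolutionOfSingularities-20038
--as helper`). OURS, AI-written, weaker than expert review; NOT a statement of any manuscript; NO geometry is proved here.

res-L1-w45b-lead-2's LEAD-MEMO-3 (sha16 025f0a6c983e7871, by hand) analyses the COMPANION escape of the BMY obstruction: a first touch at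
`η_S` whose special fibre is `S′ ∪_D R` (a d-semistable type-II degeneration of the char-0 generic fibre `X_t`, `D = S′ ∩ R` a curve of
genus `g`) has, by the standard type-II formulas,
  `K²(X_t) = K²(S′) + K²(R) + 8(g − 1)`, `c₂(X_t) = c₂(S′) + c₂(R) + 4(g − 1)`,
and Miyaoka–Yau for the (non-uniruled) `X_t` reads `β := K²(S′) − 3c₂(S′) ≤ (3c₂ − K²)(R) + 4(g − 1)`. This file is ONLY the integer
arithmetic of that sentence, so that the direction of every inequality is kernel-pinned (lead-2's «cheap sub-target for the hands»):

* `companion_bmy_iff` — `K²(X_t) ≤ 3c₂(X_t) ↔ β ≤ (3c₂ − K²)(R) + 4(g − 1)`;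
* `ruledCompanion_defect_eq` — for a ruled companion (`K²(R) = 8(1 − g)`, `c₂(R) = 4(1 − g)`): `K²(X_t) − 3c₂(X_t) = β` — the ruled
  companion does not change the BMY defect, hence
* `ruledCompanion_no_rescue` — `β > 0` (S′ still violates BMY) and `K²(X_t) ≤ 3c₂(X_t)` are contradictory: RULED COMPANIONS DO NOT RESCUE;
* `companion_rescue_threshold` — a general companion rescues BMY for `X_t` iff `(3c₂ − K²)(R) ≥ β − 4(g − 1)`: unbounded `(3c₂ − K²)(R)`
  leaves the companion branch OPEN by Chern numbers alone (MEMO-3's verdict).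

All Chern numbers enter as INTEGERS supplied by the caller; the geometric identities are HYPOTHESES. References: LEAD-MEMO-3 (OURS);
R. Friedman, *Global smoothings of varieties with normal crossings*, Ann. of Math. 118 (1983) (type-II formulas — context only);
Y. Miyaoka, Invent. Math. 42 (1977) (K² ≤ 3c₂ — context only).
-/

set_option linter.dupNamespace false -- mandated namespace `Summit.<Summit>.<Problem>` of this single-conjunct summit

namespace Summit.ResolutionOfSingularities.ResolutionOfSingularities.Theorems.EquisingularLift.K5BMY

/-- [OURS] Miyaoka–Yau for the smoothing `X_t` of `S′ ∪_D R`, rewritten through the type-II formulas: `K²(X_t) ≤ 3c₂(X_t)` iff the BMY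
defect `β = K²(S′) − 3c₂(S′)` is at most `(3c₂ − K²)(R) + 4(g − 1)`. Pure arithmetic; the two formulas are hypotheses. [folklore] -/
theorem companion_bmy_iff (KS cS KR cR KX cX g : ℤ) (hK : KX = KS + KR + 8 * (g - 1))
    (hc : cX = cS + cR + 4 * (g - 1)) :
    KX ≤ 3 * cX ↔ KS - 3 * cS ≤ (3 * cR - KR) + 4 * (g - 1) := by
  subst hK hc
  constructor <;> intro h <;> linarith

/-- [OURS] A RULED companion `R → D` (`K²(R) = 8(1 − g)`, `c₂(R) = 4(1 − g)`) leaves the BMY defect unchanged: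
`K²(X_t) − 3c₂(X_t) = K²(S′) − 3c₂(S′)`. [folklore] -/
theorem ruledCompanion_defect_eq (KS cS KR cR KX cX g : ℤ) (hK : KX = KS + KR + 8 * (g - 1))
    (hc : cX = cS + cR + 4 * (g - 1)) (hKR : KR = 8 * (1 - g)) (hcR : cR = 4 * (1 - g)) :
    KX - 3 * cX = KS - 3 * cS := by
  subst hK hc hKR hcR
  ring

/-- [OURS] **Ruled companions do not rescue BMY**: if `S′` violates BMY (`β > 0`) then the smoothing `X_t` of `S′ ∪_D R` with `R`
ruled over `D` violates it too, contradicting Miyaoka–Yau for `X_t` (hypothesis `hBMY`). [folklore] -/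
theorem ruledCompanion_no_rescue (KS cS KR cR KX cX g : ℤ) (hK : KX = KS + KR + 8 * (g - 1))
    (hc : cX = cS + cR + 4 * (g - 1)) (hKR : KR = 8 * (1 - g)) (hcR : cR = 4 * (1 - g)) (hβ : 0 < KS - 3 * cS)
    (hBMY : KX ≤ 3 * cX) : False := by
  have h := ruledCompanion_defect_eq KS cS KR cR KX cX g hK hc hKR hcR
  linarith

/-- [OURS] The rescue threshold for a GENERAL companion: `X_t` satisfies BMY iff `(3c₂ − K²)(R) ≥ β − 4(g − 1)`; since residual-intersection
companions have unbounded `(3c₂ − K²)(R)`, Chern numbers alone do not close the companion branch (LEAD-MEMO-3 (C)). [folklore] -/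
theorem companion_rescue_threshold (KS cS KR cR KX cX g : ℤ) (hK : KX = KS + KR + 8 * (g - 1))
    (hc : cX = cS + cR + 4 * (g - 1)) :
    KX ≤ 3 * cX ↔ (KS - 3 * cS) - 4 * (g - 1) ≤ 3 * cR - KR := by
  rw [companion_bmy_iff KS cS KR cR KX cX g hK hc]
  constructor <;> intro h <;> linarith

end Summit.ResolutionOfSingularities.ResolutionOfSingularities.Theorems.EquisingularLift.K5BMY
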